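import Literature.Computability.AlgebraicComplexity.CoppersmithWinograd1982Crude
import Literature.Computability.AlgebraicComplexity.StrassenMinimalBorderRank
import Literature.Computability.AlgebraicComplexity.AsymptoticRankBorderRank
import Literature.Computability.AlgebraicComplexity.LaserValueCertificate
import Literature.Computability.AlgebraicComplexity.RectangularExponentUnidimensionalAsymptotics
import Literature.Barriers.MatrixMultiplication.UniversalMethodBarrierThm29
import HarnessLib

/-!
# Route `FarEdgeDescent` — the border-rank tower: `ω(1,k,1) − (k+1) ≤ 3·k^{−1/4}` (kernel XXIV)

decomp-mm ROOT cell (D-0178), lens 2 «structural dichotomy: special vs generic», gen 48.  THESES-FREE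
(imports `Literature` only): the tensor, readout and tower layers of the proof of the route item
`PowerAmortisation` (stmt-MatrixMultiplication-25347, the open child of the special crux `FiniteSaturation`
of `closes (h₁ : FiniteSaturation) (h₂ : AnchoredLogConvexity) : MatrixMultiplication`), closed BY NAME in
the sequel `Theorems/FarEdgeDescentPowerAmortisation.lean`.  Write `e(x) = ω(1,x,1) − (x+1) ≥ 0`.

THE MECHANISM.  A *certificate* is a border-rank bound `bR(⟨c⟩ ⊗ ⟨A, M, A⟩) ≤ 29·c·A·M` for a multiple
of a far-rectangular block.  It is SELF-PROPAGATING (`tower_step`): with `q = 28·cAM`,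
* `⟨c⟩ ⊗ ⟨A,M,A⟩ ≥ ⊕_c ⟨A,M,A⟩` (relabelling), so `bR(⊕_c⟨A,M,A⟩) ≤ 29cAM =: r`;
* the CRUDE Coppersmith–Winograd augmentation for an ARBITRARY approximate algorithm of length `r`
  (Knuth, Ex. 4.6.4‑67(g) form, tree theorem `algBorderRank_innerAugment_le_add_card_left`, here UN-PINNED:
  any `r ≥ bR`, padding with zero triads) gives `bR(⟨1,q,1⟩ ⊕ ⊕_c⟨A,M,A⟩) ≤ r + cAM = 30cAM` since
  `q + cMA ≤ r`;
* the words of the 15‑th tensor power with exactly ONE anchor letter form one type class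
  `⟨15c⟩ ⊗ ⟨A, M q¹⁴, A⟩` (block extraction as a restriction), of border rank `≤ (30cAM)^15`;
* the Kronecker square is `⟨(15c)²⟩ ⊗ ⟨A², (Mq¹⁴)², A²⟩` with `bR ≤ (30cAM)^30`, and
  `30^30 ≤ 29·225·28^28` (`2.0589e44 ≤ 2.1627e44`) is exactly the new certificate
  `bR ≤ 29·(15c)²·A²·(Mq¹⁴)²`.  (Bonus ratio `Λ ↦ (Λ+1)^{n+1}/((n+1)(Λ−1)^n)`, then squared; `n = 14`,
  `Λ = 2n+1 = 29` is a fixed point.)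
READOUT (`excess_le_of_cert`): the rectangular asymptotic sum inequality with multiplicity at the real
format `x* = log M/log A` (`A^{x*} = M`) gives `c·A^{ω(1,x*,1)} ≤ R̃ ≤ bR ≤ 29cAM`, i.e. `e(x*) ≤ log 29/log A`,
and `e` is antitone.  TOWER (`tower`): from `bR(⟨1⟩⊗⟨29,1,29⟩) ≤ 841` the base `A_j = 29^{2^j}` squares at
each stage while the format exponent grows only geometrically (`M_j ≤ A_j^{3·15^j − 3}`), so
`e(k) ≤ 2^{−j}` for `k ≥ 3·15^j − 3` (`excess_le_inv_two_pow`) and finally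
`e(k) ≤ 3·k^{−1/4}` for every integer `k ≥ 1` (`powerAmortisation_bound`; true exponent `log 2/log 15`).

Why this is new (search-before-claim, cell memo NODE-g48): the printed far-edge rate is Coppersmith 1982 /
Lotti–Romani 1983, Prop. 4.1, `e(k) = O(1/log k)` (one augmentation, one type class, FIXED base); the tree's
previous best is `e(k)·log k → 0` (`FarEdgeDescentSubLogRate`).  Iterating the augmentation ON ITS OWN OUTPUT
in border rank (no border→rank conversion, the multiplicity cancels in the readout) is what turns the
logarithmic rate into a power law.  NO definitions (gate rule D-0009).
[cite: CoppersmithWinograd1982, Thm. 1] [cite: KnuthTAOCP2, §4.6.4, Ex. 67(e),(g)]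
[cite: LottiRomani1983, Prop. 3.3, Prop. 4.1] [cite: Blaser2013, Thm. 7.5]
-/

set_option linter.dupNamespace false

noncomputable section

open scoped BigOperators

namespace Summit.MatrixMultiplication.MatrixMultiplication.Theorems.FarEdgeDescentTower

open Literature.Computability.AlgebraicComplexity
open Literature.Barriers.MatrixMultiplication

variable (K : Type) [Field K]

/-! ## §1 The crude Coppersmith–Winograd augmentation, un-pinned -/

/-- **Crude augmentation from ANY border-rank bound** `bR(t) ≤ r`: `bR(t ⊕ ⟨1,q,1⟩) ≤ r + |κ|` whenever
`q + |μ| ≤ r` (pad an optimal approximate decomposition with zero triads to length `r`, then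
`algBorderRank_innerAugment_le_add_card_left`). [cite: KnuthTAOCP2, §4.6.4, Ex. 67(e),(g)] -/
theorem algBorderRank_innerAugment_le_of_le {ι κ μ : Type} [Fintype ι] [Fintype κ] [Fintype μ]
    [DecidableEq ι] [DecidableEq κ] [DecidableEq μ] (t : ι → κ → μ → K) {q r : ℕ}
    (hr : algBorderRank t ≤ r) (hq : q + Fintype.card μ ≤ r) :
    algBorderRank (innerAugment t q) ≤ r + Fintype.card κ := by
  obtain ⟨h₀, hh⟩ := exists_algBorderRank_eq_approxRank t
  rw [hh] at hr
  obtain ⟨w, u, v, hd⟩ := exists_isApproxDecomposition_of_approxRank_le hr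
  exact algBorderRank_innerAugment_le_add_card_left hd hq

/-- The same in the format of a direct sum of blocks (cost = the `X`-leg `∑ᵢ kᵢmᵢ`):
`bR(⟨1,q,1⟩ ⊕ ⊕ᵢ⟨kᵢ,mᵢ,nᵢ⟩) ≤ r + ∑ᵢ kᵢmᵢ` whenever `bR(⊕ᵢ⟨kᵢ,mᵢ,nᵢ⟩) ≤ r` and `q + ∑ᵢ mᵢnᵢ ≤ r`.
[cite: KnuthTAOCP2, §4.6.4, Ex. 67(e),(g)] -/
theorem algBorderRank_cons_inner_le_of_le {p : ℕ} (k m n : Fin p → ℕ) {q r : ℕ}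
    (hr : algBorderRank (matMulDirectSum K k m n) ≤ r) (hq : q + ∑ i, m i * n i ≤ r) :
    algBorderRank (matMulDirectSum K (Fin.cons 1 k) (Fin.cons q m) (Fin.cons 1 n)) ≤
      r + ∑ i, k i * m i := by
  classical
  have hY : Fintype.card (Σ i, Fin (m i) × Fin (n i)) = ∑ i, m i * n i := by
    simp [Fintype.card_prod]
  have hX : Fintype.card (Σ i, Fin (k i) × Fin (m i)) = ∑ i, k i * m i := by
    simp [Fintype.card_prod]
  have h := algBorderRank_innerAugment_le_of_le K (matMulDirectSum K k m n) hr (q := q)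
    (by rw [hY]; exact hq)
  rw [hX] at h
  calc algBorderRank (matMulDirectSum K (Fin.cons 1 k) (Fin.cons q m) (Fin.cons 1 n))
      ≤ algBorderRank (innerAugment (matMulDirectSum K k m n) q) := by
        rw [matMulDirectSum_cons_inner]
        exact algBorderRank_precomp_le _ _ _ _
    _ ≤ _ := h

/-! ## §2 One stage of the tower -/

/-- `⟨c⟩ ⊗ ⟨A,M,A⟩ ≥ ⊕_{i<c} ⟨A,M,A⟩` (relabelling). [cite: Blaser2013, §5.2 p. 24] -/
theorem tensorRestrictsTo_multiple_directSum (c A M : ℕ) :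
    TensorRestrictsTo (kroneckerTensor (unitTensor K c) (matMulTensor K A M A))
      (matMulDirectSum K (fun _ : Fin c => A) (fun _ => M) (fun _ => A)) := by
  classical
  have r1 := (TensorRestrictsTo.refl (unitTensor K c)).kronecker
    (tensorRestrictsTo_matMulTensor_matMulDirectSum_single K A M A)
  have r2 := tensorRestrictsTo_unit_kronecker_matMulDirectSum K c
    (fun _ : Fin 1 => A) (fun _ => M) (fun _ => A)
  have r3 := tensorRestrictsTo_matMulDirectSum_reindex K
    (fun j : Fin (c * 1) => (fun _ : Fin 1 => A) (finProdFinEquiv.symm j).2)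
    (fun j => (fun _ : Fin 1 => M) (finProdFinEquiv.symm j).2)
    (fun j => (fun _ : Fin 1 => A) (finProdFinEquiv.symm j).2)
    (Fin.cast (Nat.mul_one c).symm) (Fin.cast_injective _)
  exact (r1.trans r2).trans r3

/-- **The stage.**  A certificate `bR(⟨c⟩ ⊗ ⟨A,M,A⟩) ≤ 29·cAM` propagates to
`bR(⟨(15c)²⟩ ⊗ ⟨A², (M q¹⁴)², A²⟩) ≤ 29·(15c)²·A²·(Mq¹⁴)²` with `q = 28·cAM`: crude augmentation
(`bR(⟨1,q,1⟩ ⊕ ⊕_c⟨A,M,A⟩) ≤ 30cAM`), the one-anchor-letter type class of the 15‑th power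
(`⟨15c⟩ ⊗ ⟨A, Mq¹⁴, A⟩`, Lotti–Romani Prop. 3.3 / Bläser Thm. 7.5 block extraction), the Kronecker square,
and `30^30 ≤ 29·225·28^28`. [cite: LottiRomani1983, Prop. 3.3] [cite: KnuthTAOCP2, §4.6.4, Ex. 67(g)] -/
theorem tower_step {c A M X q : ℕ} (hX : X = c * (A * M)) (hq : q = 28 * X)
    (h : algBorderRank (kroneckerTensor (unitTensor K c) (matMulTensor K A M A)) ≤ 29 * X) :
    algBorderRank (kroneckerTensor (unitTensor K ((15 * c) ^ 2))
        (matMulTensor K (A ^ 2) ((M * q ^ 14) ^ 2) (A ^ 2))) ≤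
      29 * ((15 * c) ^ 2 * (A ^ 2 * (M * q ^ 14) ^ 2)) := by
  classical
  -- (a) the direct sum of `c` blocks
  have hds : algBorderRank (matMulDirectSum K (fun _ : Fin c => A) (fun _ => M) (fun _ => A)) ≤
      29 * X := (tensorRestrictsTo_multiple_directSum K c A M).algBorderRank_le.trans h
  -- (b) the crude augmentation by `⟨1, q, 1⟩`
  set D := matMulDirectSum K (Fin.cons 1 (fun _ : Fin c => A)) (Fin.cons q (fun _ : Fin c => M))
    (Fin.cons 1 (fun _ : Fin c => A)) with hD
  have hsumY : ∑ _i : Fin c, M * A = X := by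
    rw [Finset.sum_const, Finset.card_univ, Fintype.card_fin, smul_eq_mul, hX]; ring
  have hsumX : ∑ _i : Fin c, A * M = X := by
    rw [Finset.sum_const, Finset.card_univ, Fintype.card_fin, smul_eq_mul, hX]
  have haug : algBorderRank D ≤ 29 * X + X := by
    have h' := algBorderRank_cons_inner_le_of_le K (fun _ : Fin c => A) (fun _ => M) (fun _ => A)
      hds (q := q) (by rw [hsumY]; omega)
    rwa [hsumX] at h'
  -- (c) the words with exactly one anchor letter: position `(e β).1`, anchor block `(e β).2`
  set e : Fin (15 * c) → Fin 15 × Fin c := fun β => finProdFinEquiv.symm β with he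
  set rep : Fin (15 * c) → Fin 15 → Fin (c + 1) :=
    fun β j => if j = (e β).1 then ((e β).2).succ else 0 with hrep
  have hinj : Function.Injective rep := by
    intro β β' hββ'
    have h1 := congrFun hββ' (e β).1
    simp only [hrep, if_true] at h1
    have hpos : (e β).1 = (e β').1 := by
      by_contra hne
      rw [if_neg hne] at h1
      exact Fin.succ_ne_zero _ h1
    rw [hpos, if_pos rfl] at h1
    have hblk : (e β).2 = (e β').2 := Fin.succ_inj.1 h1
    exact finProdFinEquiv.symm.injective (Prod.ext hpos hblk)
  have hK : ∀ β, ∏ j, (Fin.cons 1 (fun _ : Fin c => A) : Fin (c + 1) → ℕ) (rep β j) = A := by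
    intro β
    have hf : (fun j => (Fin.cons 1 (fun _ : Fin c => A) : Fin (c + 1) → ℕ) (rep β j)) =
        fun j => if j = (e β).1 then A else 1 := funext fun j => by
      simp only [hrep]; split_ifs <;> simp
    rw [hf, Finset.prod_ite_eq']; simp
  have hN : ∀ β, ∏ j, (Fin.cons 1 (fun _ : Fin c => A) : Fin (c + 1) → ℕ) (rep β j) = A := hK
  have hM : ∀ β, ∏ j, (Fin.cons q (fun _ : Fin c => M) : Fin (c + 1) → ℕ) (rep β j) =
      M * q ^ 14 := by
    intro β
    have hf : (fun j => (Fin.cons q (fun _ : Fin c => M) : Fin (c + 1) → ℕ) (rep β j)) =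
        fun j => if j = (e β).1 then M else q := funext fun j => by
      simp only [hrep]; split_ifs <;> simp
    rw [hf, Fin.prod_univ_succAbove _ (e β).1, if_pos rfl,
      Finset.prod_congr rfl fun j _ => if_neg (Fin.succAbove_ne (e β).1 j), Finset.prod_const,
      Finset.card_univ, Fintype.card_fin]
  have hcls : TensorRestrictsTo (kroneckerPow D 15)
      (kroneckerTensor (unitTensor K (15 * c)) (matMulTensor K A (M * q ^ 14) A)) :=
    tensorRestrictsTo_kroneckerPow_matMulDirectSum_multiple K _ _ _ rep hinj hK hM hN
  -- (d) the Kronecker square, (e) the arithmetic of the fixed point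
  have hsq := tensorRestrictsTo_kroneckerPow_multiple_matMulTensor K (15 * c) A (M * q ^ 14) A 2
  set T := kroneckerTensor (unitTensor K (15 * c)) (matMulTensor K A (M * q ^ 14) A) with hT
  calc algBorderRank (kroneckerTensor (unitTensor K ((15 * c) ^ 2))
          (matMulTensor K (A ^ 2) ((M * q ^ 14) ^ 2) (A ^ 2)))
        ≤ algBorderRank (kroneckerPow T 2) := hsq.algBorderRank_le
    _ ≤ algBorderRank T ^ 2 := algBorderRank_kroneckerPow_le T 2
    _ ≤ algBorderRank (kroneckerPow D 15) ^ 2 := Nat.pow_le_pow_left hcls.algBorderRank_le 2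
    _ ≤ (algBorderRank D ^ 15) ^ 2 := Nat.pow_le_pow_left (algBorderRank_kroneckerPow_le D 15) 2
    _ ≤ ((29 * X + X) ^ 15) ^ 2 := Nat.pow_le_pow_left (Nat.pow_le_pow_left haug 15) 2
    _ = 30 ^ 30 * X ^ 30 := by ring
    _ ≤ (29 * 15 ^ 2 * 28 ^ 28) * X ^ 30 := Nat.mul_le_mul_right _ (by norm_num)
    _ = 29 * ((15 * c) ^ 2 * (A ^ 2 * (M * q ^ 14) ^ 2)) := by rw [hq, hX]; ring

/-! ## §3 The readout at the far edge -/

/-- **Readout.**  A certificate `bR(⟨c⟩ ⊗ ⟨A,M,A⟩) ≤ 29·cAM` (`c, M ≥ 1`, `A ≥ 2`) bounds the far-edge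
excess by `e(k) ≤ log 29 / log A` for every real `k ≥ log M / log A`: at `x* = log M/log A` one has
`A^{x*} = M`, so the rectangular asymptotic sum inequality with multiplicity
(`mul_rpow_omegaRect_mid_le_asymptoticRank`) and `R̃ ≤ bR` give `c·A^{ω(1,x*,1)} ≤ 29cAM`, i.e.
`e(x*) ≤ log 29/log A`; and `x ↦ ω(1,x,1) − x` is antitone.
[cite: AlmanDuanVassilevskaWilliamsXuXuZhou2025, Thm. 3.2] [cite: LottiRomani1983, Prop. 4.1] -/
theorem excess_le_of_cert {c A M X : ℕ} (hc : 1 ≤ c) (hA : 2 ≤ A) (hM : 1 ≤ M)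
    (hX : X = c * (A * M))
    (h : algBorderRank (kroneckerTensor (unitTensor K c) (matMulTensor K A M A)) ≤ 29 * X)
    {k : ℝ} (hk : Real.log M / Real.log A ≤ k) :
    omegaRect K 1 k 1 - (k + 1) ≤ Real.log 29 / Real.log A := by
  have hA0 : (0 : ℝ) < A := by exact_mod_cast (by omega : 0 < A)
  have hM0 : (0 : ℝ) < M := by exact_mod_cast (by omega : 0 < M)
  have hc0 : (0 : ℝ) < c := by exact_mod_cast (by omega : 0 < c)
  have hlA : 0 < Real.log A := Real.log_pos (by exact_mod_cast (by omega : 1 < A))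
  have hlM : 0 ≤ Real.log M := Real.log_nonneg (by exact_mod_cast hM)
  set x : ℝ := Real.log M / Real.log A with hx
  have hx0 : 0 ≤ x := div_nonneg hlM hlA.le
  have hxA : x * Real.log A = Real.log M := div_mul_cancel₀ _ hlA.ne'
  have hAx : (A : ℝ) ^ x ≤ (M : ℕ) := by
    rw [Real.rpow_def_of_pos hA0, mul_comm, hxA, Real.exp_log hM0]
  have h1 := mul_rpow_omegaRect_mid_le_asymptoticRank K hx0 hc hA hAx
  have h2 : asymptoticRank (kroneckerTensor (unitTensor K c) (matMulTensor K A M A)) ≤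
      ((29 * X : ℕ) : ℝ) := by exact_mod_cast asymptoticRank_le_of_algBorderRank_le h
  have h3 : (A : ℝ) ^ omegaRect K 1 x 1 ≤ 29 * (A * M) := by
    have h12 := h1.trans h2
    rw [hX] at h12
    push_cast at h12
    have : (c : ℝ) * (A : ℝ) ^ omegaRect K 1 x 1 ≤ c * (29 * (A * M)) := by nlinarith
    exact le_of_mul_le_mul_left this hc0
  have h4 : omegaRect K 1 x 1 * Real.log A ≤ Real.log 29 + Real.log A + Real.log M := by
    have h' := Real.log_le_log (Real.rpow_pos_of_pos hA0 _) h3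
    rw [Real.log_rpow hA0, Real.log_mul (by norm_num) (by positivity),
      Real.log_mul hA0.ne' hM0.ne'] at h'
    linarith
  have h5 : omegaRect K 1 x 1 - (x + 1) ≤ Real.log 29 / Real.log A := by
    rw [le_div_iff₀ hlA]
    nlinarith
  have h6 := omegaRect_one_mid_one_sub_antitone K hk
  simp only at h6
  linarith

/-! ## §4 The tower -/

/-- **The tower of certificates.**  Stage `j`: base `A = 29^{2^j}`, some multiplicity `c ≥ 1` with
`225c ≤ A²` and some middle dimension `M ≥ 1` with `M·A³ ≤ A^{3·15^j}`, and the certificate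
`bR(⟨c⟩ ⊗ ⟨A,M,A⟩) ≤ 29·cAM`.  Base `bR(⟨1⟩ ⊗ ⟨29,1,29⟩) ≤ 1·841`; step = `tower_step`.
[cite: KnuthTAOCP2, §4.6.4, Ex. 67(g)] [cite: LottiRomani1983, Prop. 3.3] -/
theorem tower (j : ℕ) : ∃ c M : ℕ, 1 ≤ c ∧ 1 ≤ M ∧ 225 * c ≤ (29 ^ 2 ^ j) ^ 2 ∧
    M * (29 ^ 2 ^ j) ^ 3 ≤ (29 ^ 2 ^ j) ^ (3 * 15 ^ j) ∧
    algBorderRank (kroneckerTensor (unitTensor K c) (matMulTensor K (29 ^ 2 ^ j) M (29 ^ 2 ^ j))) ≤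
      29 * (c * (29 ^ 2 ^ j * M)) := by
  classical
  induction j with
  | zero =>
    refine ⟨1, 1, le_rfl, le_rfl, by norm_num, by norm_num, ?_⟩
    simp only [pow_zero, pow_one]
    have h1 : tensorRank (unitTensor K 1) ≤ 1 := by
      refine tensorRank_le_of_eq_sum (fun _ _ => (1 : K)) (fun _ _ => 1) (fun _ _ => 1) ?_
      funext a b c
      rw [unitTensor_one, Finset.sum_apply, Finset.sum_apply, Finset.sum_apply]
      simp [triad_apply]
    calc algBorderRank (kroneckerTensor (unitTensor K 1) (matMulTensor K 29 1 29))
        ≤ algBorderRank (unitTensor K 1) * algBorderRank (matMulTensor K 29 1 29) :=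
          algBorderRank_kroneckerTensor_le _ _
      _ ≤ 1 * (29 * 1 * 29) :=
          Nat.mul_le_mul ((algBorderRank_le_tensorRank _).trans h1)
            ((algBorderRank_le_tensorRank _).trans (tensorRank_matMulTensor_le K 29 1 29))
      _ = 29 * (1 * (29 * 1)) := by norm_num
  | succ j ih =>
    obtain ⟨c, M, hc, hM, hcA, hMA, hcert⟩ := ih
    rw [show 29 ^ 2 ^ (j + 1) = (29 ^ 2 ^ j) ^ 2 by rw [pow_succ, pow_mul]]
    have hApos : 0 < 29 ^ 2 ^ j := by positivity
    generalize 29 ^ 2 ^ j = A at hcA hMA hcert hApos ⊢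
    have hstep := tower_step K (X := c * (A * M)) (q := 28 * (c * (A * M))) rfl rfl hcert
    have h28 : 28 * c ≤ A ^ 2 := (Nat.mul_le_mul_right c (by norm_num : 28 ≤ 225)).trans hcA
    have hq0 : 0 < M * (28 * (c * (A * M))) ^ 14 := by positivity
    refine ⟨(15 * c) ^ 2, (M * (28 * (c * (A * M))) ^ 14) ^ 2, Nat.one_le_pow _ _ (by omega),
      Nat.one_le_pow _ _ hq0, ?_, ?_, hstep⟩
    · calc 225 * (15 * c) ^ 2 = (225 * c) ^ 2 := by ring
        _ ≤ (A ^ 2) ^ 2 := Nat.pow_le_pow_left hcA 2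
    · calc (M * (28 * (c * (A * M))) ^ 14) ^ 2 * (A ^ 2) ^ 3
          = (28 * c) ^ 28 * (A ^ 34 * M ^ 30) := by ring
        _ ≤ (A ^ 2) ^ 28 * (A ^ 34 * M ^ 30) := Nat.mul_le_mul_right _ (Nat.pow_le_pow_left h28 28)
        _ = (M * A ^ 3) ^ 30 := by ring
        _ ≤ (A ^ (3 * 15 ^ j)) ^ 30 := Nat.pow_le_pow_left hMA 30
        _ = (A ^ 2) ^ (3 * 15 ^ (j + 1)) := by
          rw [← pow_mul, ← pow_mul, pow_succ]; ring_nf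

/-- **`e(k) ≤ 2^{−j}` for every real `k ≥ 3·15^j − 3`** (readout of stage `j` of the tower:
`log M_j / log A_j ≤ 3·15^j − 3` and `log 29 / log A_j = 2^{−j}`). [cite: LottiRomani1983, Prop. 4.1] -/
theorem excess_le_inv_two_pow (j : ℕ) {k : ℝ} (hk : 3 * (15 : ℝ) ^ j - 3 ≤ k) :
    omegaRect K 1 k 1 - (k + 1) ≤ 1 / (2 : ℝ) ^ j := by
  obtain ⟨c, M, hc, hM, -, hMA, hcert⟩ := tower K j
  have hA2 : 2 ≤ 29 ^ 2 ^ j := le_trans (by norm_num) (Nat.le_self_pow (by positivity) 29)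
  have hlog : Real.log ((29 ^ 2 ^ j : ℕ) : ℝ) = (2 : ℝ) ^ j * Real.log 29 := by
    push_cast
    rw [Real.log_pow]; push_cast; ring
  generalize 29 ^ 2 ^ j = A at hA2 hlog hMA hcert
  have hA0 : (0 : ℝ) < A := by exact_mod_cast (by omega : 0 < A)
  have hlA : 0 < Real.log (A : ℝ) := Real.log_pos (by exact_mod_cast (by omega : 1 < A))
  have hM0 : (0 : ℝ) < M := by exact_mod_cast (by omega : 0 < M)
  -- the threshold `log M / log A ≤ 3·15^j − 3`
  have hthr : Real.log M / Real.log (A : ℝ) ≤ 3 * (15 : ℝ) ^ j - 3 := by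
    rw [div_le_iff₀ hlA]
    have h' : (M : ℝ) * (A : ℝ) ^ 3 ≤ (A : ℝ) ^ (3 * 15 ^ j) := by exact_mod_cast hMA
    have h'' := Real.log_le_log (by positivity) h'
    rw [Real.log_mul hM0.ne' (by positivity), Real.log_pow, Real.log_pow] at h''
    push_cast at h''
    linarith
  have h := excess_le_of_cert K hc hA2 hM rfl hcert (hthr.trans hk)
  rw [hlog] at h
  have hl29 : 0 < Real.log 29 := Real.log_pos (by norm_num)
  calc omegaRect K 1 k 1 - (k + 1) ≤ Real.log 29 / ((2 : ℝ) ^ j * Real.log 29) := h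
    _ = 1 / (2 : ℝ) ^ j := by field_simp

/-! ## §5 Polynomial amortisation of the far-edge excess -/

/-- **`ω(1,k,1) − (k+1) ≤ 3·k^{−1/4}` for every integer `k ≥ 1`**, over every field — the statement of the
route item `PowerAmortisation` with `δ = 1/4`, `C = 3` (stage `j = ⌊log₁₅((k+3)/3)⌋` of the tower:
`3·15^j − 3 ≤ k < 45·15^j ≤ 81·16^j = (3·2^j)^4`, so `2^{−j} ≤ 3·k^{−1/4}`).
[cite: LottiRomani1983, Prop. 4.1] [cite: CoppersmithWinograd1982, Thm. 1] -/
theorem powerAmortisation_bound : ∃ δ C : ℝ, 0 < δ ∧ ∀ k : ℕ, 1 ≤ k →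
    omegaRect K 1 k 1 - (k + 1) ≤ C * (k : ℝ) ^ (-δ) := by
  refine ⟨1 / 4, 3, by norm_num, fun k hk => ?_⟩
  set j := Nat.log 15 ((k + 3) / 3) with hj
  have hlow : 15 ^ j ≤ (k + 3) / 3 := Nat.pow_log_le_self 15 (by omega)
  have hup : (k + 3) / 3 < 15 ^ (j + 1) := Nat.lt_pow_succ_log_self (by norm_num) _
  have hlow' : 3 * 15 ^ j ≤ k + 3 := by omega
  have hup' : k < 81 * 16 ^ j := by
    have h1 : k + 3 < 3 * 15 ^ (j + 1) := by omega
    have h2 : 15 ^ (j + 1) ≤ 15 * 16 ^ j := by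
      rw [pow_succ']; exact Nat.mul_le_mul_left 15 (Nat.pow_le_pow_left (by norm_num) j)
    omega
  have hk0 : (0 : ℝ) < k := by exact_mod_cast (by omega : 0 < k)
  have he := excess_le_inv_two_pow K j (k := (k : ℝ))
    (by have : ((3 * 15 ^ j : ℕ) : ℝ) ≤ ((k + 3 : ℕ) : ℝ) := by exact_mod_cast hlow'
        push_cast at this; linarith)
  -- `k^{1/4} ≤ 3·2^j`
  have hroot : (k : ℝ) ^ (1 / 4 : ℝ) ≤ 3 * (2 : ℝ) ^ j := by
    have h1 : (k : ℝ) ≤ (3 * (2 : ℝ) ^ j) ^ (4 : ℕ) := by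
      have : ((k : ℕ) : ℝ) ≤ ((81 * 16 ^ j : ℕ) : ℝ) := by exact_mod_cast hup'.le
      push_cast at this
      calc (k : ℝ) ≤ 81 * 16 ^ j := this
        _ = (3 * (2 : ℝ) ^ j) ^ (4 : ℕ) := by
          rw [mul_pow, ← pow_mul, show (16 : ℝ) = 2 ^ 4 by norm_num, ← pow_mul]; ring
    have h2 := Real.rpow_le_rpow hk0.le h1 (by norm_num : (0 : ℝ) ≤ 1 / 4)
    rwa [← Real.rpow_natCast, ← Real.rpow_mul (by positivity), show ((4 : ℕ) : ℝ) * (1 / 4) = 1 by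
      norm_num, Real.rpow_one] at h2
  have hkr : 0 < (k : ℝ) ^ (1 / 4 : ℝ) := Real.rpow_pos_of_pos hk0 _
  calc omegaRect K 1 k 1 - (k + 1) ≤ 1 / (2 : ℝ) ^ j := he
    _ = 3 / (3 * (2 : ℝ) ^ j) := by field_simp
    _ ≤ 3 / (k : ℝ) ^ (1 / 4 : ℝ) := div_le_div_of_nonneg_left (by norm_num) hkr hroot
    _ = 3 * (k : ℝ) ^ (-(1 / 4 : ℝ)) := by rw [Real.rpow_neg hk0.le, div_eq_mul_inv]

end Summit.MatrixMultiplication.MatrixMultiplication.Theorems.FarEdgeDescentTower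

end
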